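import Summits.BirchSwinnertonDyer.BirchSwinnertonDyer.Theorems.EisensteinPrimesB11SplitRoutePDoor
import Summits.BirchSwinnertonDyer.BirchSwinnertonDyer.Theorems.EisensteinPrimesB11L3MainConjecture
import Summits.BirchSwinnertonDyer.Rank1Residual.X11b.ChaPairsMinimality
import Summits.BirchSwinnertonDyer.Rank1Residual.Supersingular.IntModelMinimalityKrausTwoMore
import Summits.BirchSwinnertonDyer.BirchSwinnertonDyer.Theorems.Rank1ResidualX11RankOneReduction
import Summits.BirchSwinnertonDyer.Rank1Residual.Partition.EisensteinKernelCertificate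
import HarnessLib

/-!
# Row B11 = cell X2c (rank 1, Eisenstein, `3 ‖ N`), sub-cell `X2.CellCSplitNotGV`, SPLIT, `λ_an = 4`: Mazur's cyclotomic
# main conjecture at `(618c1, 3)` on TWO Keller–Yin-free roads — route P at a split prime (door
# `B11SplitRouteP.mazurMC_of_cellC_of_split_of_routeP`, p545576) and the L3 certificate (door
# `B11L3.cellC_mazurMainConjectureAt_of_split_of_thm16_of_l3Certificate`, p547040) — plus `BSD(618c1, 3)` from the
# same L3 certificate (k5-p3's door), modulo PUBLISHED facts + the pair's instrument readings (cell `bsd-eis`,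
# seat `bsd-eis-k5-c4` gen 10; route `EisensteinPrimes`, crux 4 `BSDpOnCellC` = `X2.TargetC` =
# stmt-BirchSwinnertonDyer-19034; THEOREMS ONLY; generated by `work/disp/gen_rpsplit.py`; membership template =
# k5-p3 `gen_l3.py` / k5-c4 g8 `gen_display.py` / p427884)

HONEST FRAMING (FULL-BSD rank-≤1 programme D-0033, cell `bsd-eis`, home `run/shared/lean/pub/bsd-eis/`;
row B11 = X2c: 12 665 census cells `(E, p)` with `r_an = 1`, `p` odd, `p ‖ N`, `E[p]` reducible; O9 atlas
`class-closure/O9/E2-hypotheses.tsv`). Nothing is booked here and no label or count moves: X2c stays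
CONSTRUCTION-SHAPED as a class; BSD is proved for no curve by this file unconditionally. Per-pair CONDITIONAL
theorems: the class-level inputs are the tree's registered PUBLISHED facts BY NAME, the per-pair inputs are
instrument READINGS (two engines each, named below).

TARGET `W = 618c1 = [1, 0, 1, -21, 34]` (Cremona `allcurves`, reduced minimal model): `N = 618 = 2·3·103`,
`Δ = -5562` (`|Δ| = 2·3³·103`), `c₄ = 985`, `c₆ = -31069`; Cremona `allcurves`/`allbsd`/`allgens`: `r = 1`,
`#E(ℚ)_tors = 3`, `∏ c_v = 3`, `Ω = 4.30342325750240`, `L'(E,1) = 1.73222415858646`, `Reg = 1.20756713081841`, `Ш_an = 1.00000000000000`, generator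
`P = [4:2:1]`; isogeny class `618c` (Cremona `allisog`: curves [1,0,1,-21,34], degree matrix [[1,0,1,-21,34],[1,0,1,54,196]]).
O9 atlas row `618c1@3`: sub-cell `split-notGV = Summit.BirchSwinnertonDyer.Rank1Residual.X2.CellCSplitNotGV`; `ord_3 #Ш_an = 0`; booking of record `B11 row of record (planner b11status, R796)` (referee B R796).

KERNEL-PROVED here (no hypothesis): ellipticity; global minimality (bounded Kraus–Silverman criterion, trial division below 512); `W` is multiplicative at `3` (`3 ∣ Δ`, `3 ∤ c₄`) and SPLIT there (node-tangent root `t = 0` mod `3`; `a_3 = +1`); `W[3]` is reducible (the rational `Ψ₃`-root `x₀ = 2` with `Ψ₂Sq(x₀) = 9 ≠ 0` spans a rational `3`-line); hence `ClassX2 W 3`, and `CellC W 3` given the rank.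
PER-PAIR INSTRUMENT READINGS (hypotheses, not mathematics of this file; keys `HOME/k5-c4-g10/B11S-RP-keys.tsv` +
`B11-L3W1b-vb2-keys.tsv` row `618c1@3`): `hr : r_an = 1` [Cremona `allbsd` ‖ PARI]; `hμ0 : AnalyticMuLE W 3 0`,
`hlam4 : AnalyticLambdaEq W 3 4` [(μ, λ) = (0, 4): A PARI `ellpadiclambdamu` ‖ B msengine (`O9/LAMMIN-CLASS-typer6.tsv`
(0,4) A=B) ‖ C this seat's engine v5 exact Mazur–Tate element (kit j283329, two levels)]; `hk : k = 2 ≤ ord_3 𝓛_3` for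
every Tate parameter datum [`R4`: PARI Tate `q` ‖ own `q` by j-inversion, k5-p3 JD #39]; `hv : v = 2 ≤ ord_3 Reg_3` for THE
split §4.2 height whenever `Reg_3 ≠ 0` [`R3`: PARI `ellpadicregulator` ‖ census REG-MULT σ-height, e1 = e2 = 2];
`ord_3 #E(ℚ)_tors = 1`, `ord_3 ∏c_v = 1` [Cremona `allbsd`] — so the route-P inequality reads
`2 + 2·1 < 2 + 2 + 1` ✓; `hcert` (L3, the binder of record R788): `ord_{T=0} L = 2` and
`v_3(ϖ·[T²]L·log_3(γ_cyc)²·#tors²) = v_3(𝓛_3·∏c_v·Reg_3)` [engine C v5: `v_3(b₂) = 1` exact, conclusive at level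
`K` (`< K − 1`), trivial-zero check `b₁ ≡ 0 (mod 3^(K−1))` ✓; identity `1 + 2 + 2·1 = 2 + 1 + 2` ✓ ‖ E1 = PARI
`ellpadicbsd` (k5-p3 LEG W-E1)]; `hsha : 3 ∤ #Ш_an` [Cremona: `Ш_an = 1.00000000000000`].
CLASS-LEVEL INPUTS, all REGISTERED Literature facts [PUB] BY NAME: `hWu` Wuthrich 2014 Thm. 16, `hJs`/`hJn` Stein–Wuthrich
2013 Thm. 6.1, `h310` Greenberg LNM 1716 Prop. 3.10, `hGZ` Gross–Zagier I.7.3, `hGZK`, `hpar`. No Greenberg–Vatsal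
fact (the roads are parity-free), no partner / relative / twist, no anticyclotomic object, no Schneider hypothesis, no
`_OPEN` / preprint fact, no crux 3: KELLER–YIN-FREE.

* §3a `mazurMC_618c1_at_three_routeP` — route P (split): `(μ,λ) = (0,4)` + `k` + `v` + inequality ⟹ `X2.MazurMainConjectureAt W 3`.
* §3b `mazurMC_618c1_at_three_l3` — the L3 certificate (k5-p3 g2's door) ⟹ `X2.MazurMainConjectureAt W 3` (second road,
  disjoint readings on the L-side: no `(μ, λ)`, no inequality).
* §3c `bsdp_618c1_at_three_l3` / `targetC_618c1_at_three_l3` — the SAME certificate + `hsha` ⟹ `BSDp W 3` (k5-p3's door;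
  crux 4's `X2.TargetC` shape).
What this is NOT: not a booking; not the crux (the CLASS); `BSD(E,p)` does NOT come from route P at a split prime
(exceptional-zero leading term for reducible `E[p]` = typed conjecture `O9.ExceptionalLeadingTermAt`) — it comes from §3c.
Refs: [GreenbergLNM1716] Prop. 3.10, §5 p. 183 (printed p. 142); [Wuthrich2014] Thm. 16 (p. 397); [SteinWuthrich2013]
Thm. 6.1 (p. 20), §4.2, §4.4, §11 remark (p. 29); [SilvermanAEC2009] VII.1 Rem. 1.1, VII.5 Prop. 5.1(b), Ex. 3.7;
[Kraus1989] Prop. 1–2; [Miller2011LMS] Def. 1.1, Prop. 7.6; Cremona `ecdata`.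
-/

set_option autoImplicit false
set_option linter.dupNamespace false

noncomputable section

open scoped Classical MatrixGroups ModularForm

open WeierstrassCurve NumberField IsDedekindDomain Polynomial CongruenceSubgroup
  Literature.NumberTheory.EllipticCurves
  Literature.NumberTheory.EllipticCurves.ModularForms
  Literature.NumberTheory.EllipticCurves.Rank1Residual
  Literature.NumberTheory.EllipticCurves.Rank1Residual.Typed
  Literature.NumberTheory.EllipticCurves.Greenberg1999
  Literature.NumberTheory.EllipticCurves.Wuthrich2014
  Literature.NumberTheory.EllipticCurves.SteinWuthrich2013
  Summit.BirchSwinnertonDyer.BirchSwinnertonDyer.Rank1Residual.IntModel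
  Summit.BirchSwinnertonDyer.BirchSwinnertonDyer.Rank1Residual.X11RankOne
  Summit.BirchSwinnertonDyer.Rank1Residual.X11b
  Summit.BirchSwinnertonDyer.Rank1Residual
  Summit.BirchSwinnertonDyer.Rank1Residual.X2
  Summit.BirchSwinnertonDyer.BirchSwinnertonDyer.Theorems

namespace Summit.BirchSwinnertonDyer.BirchSwinnertonDyer.Theorems.B11SplitRouteP618c1

/-! ## §1 The equation: elliptic, globally minimal, SPLIT multiplicative at `3` -/

/-- `618c1 = [1, 0, 1, -21, 34]` is elliptic (`Δ = -5562 ≠ 0`). [folklore] -/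
theorem isElliptic_618c1 : (⟨1, 0, 1, (-21), 34⟩ : WeierstrassCurve ℚ).IsElliptic :=
  isElliptic_of_discOf_ne_zero 1 0 1 (-21) 34 (by decide +kernel)

set_option maxRecDepth 100000 in
/-- `618c1` is globally minimal (bounded Kraus–Silverman criterion, trial division below 512, `decide`).
[cite: SilvermanAEC2009, VII.1 Remark 1.1] [cite: Kraus1989, Prop. 1 and Prop. 2] -/
theorem isGloballyMinimal_618c1 : (⟨1, 0, 1, (-21), 34⟩ : WeierstrassCurve ℚ).IsGloballyMinimal :=
  isGloballyMinimal_of_krausCriterion_bounded 1 0 1 (-21) 34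
    (by decide +kernel) (by decide +kernel) (by decide +kernel)

/-- **`618c1` is SPLIT multiplicative at `3`** (`3 ∣ Δ`, `3 ∤ c₄ = 985`; node-tangent root `t = 0`
mod `3`; `a_3 = +1`). [cite: SilvermanAEC2009, VII.5 Prop. 5.1(b)] -/
theorem split_618c1 : (⟨1, 0, 1, (-21), 34⟩ : WeierstrassCurve ℚ).HasSplitMultiplicativeReductionAtPrime 3 := by
  haveI := isElliptic_618c1
  haveI := isGloballyMinimal_618c1
  have hI := integralModelInt_eq_of_map_eq (W := (⟨1, 0, 1, (-21), 34⟩ : WeierstrassCurve ℚ)) _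
    (map_mk_int 1 0 1 (-21) 34)
  refine hasSplitMultiplicativeReductionAtPrime_of_intModel_of_root hI 3
    (by rw [intCurve_Δ]; decide +kernel) (by rw [intCurve_c₄]; decide +kernel) ⟨0, ?_⟩
  simp only [WeierstrassCurve.c₄, WeierstrassCurve.b₂, WeierstrassCurve.b₄, WeierstrassCurve.b₆]
  push_cast
  decide

/-! ## §2 The Galois side: `618c1[3]` is reducible -/

/-- **`618c1[3]` is reducible — IN THE KERNEL**: `x₀ = 2` is a rational root of `Ψ₃` with
`Ψ₂Sq(x₀) = 9 ≠ 0` (it spans a rational `3`-line = the kernel of the rational `3`-isogeny inside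
class `618c`). [cite: SilvermanAEC2009, Ex. 3.7 and III.2.3] -/
theorem not_irreducible_618c1 : ¬ (⟨1, 0, 1, (-21), 34⟩ : WeierstrassCurve ℚ).HasIrreducibleModPGaloisRep 3 := by
  haveI := isElliptic_618c1
  obtain ⟨Φ, P, y, h, hΦ, -⟩ :=
    KernelDisc.exists_isRationalLine_of_eval_Ψ₃_eq_zero (W := ⟨1, 0, 1, (-21), 34⟩) (2)
      (by norm_num [WeierstrassCurve.Ψ₃, WeierstrassCurve.b₂, WeierstrassCurve.b₄, WeierstrassCurve.b₆,
            WeierstrassCurve.b₈])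
      (by rw [KernelDisc.eval_Ψ₂Sq]; norm_num [WeierstrassCurve.b₂, WeierstrassCurve.b₄, WeierstrassCurve.b₆])
  exact not_hasIrreducibleModPGaloisRep_of_isRationalLine hΦ

/-- **`(618c1, 3)` lies in class X2** (`3` odd, `E[3]` reducible, `3 ‖ N` multiplicative) — in the kernel.
[folklore] -/
theorem classX2_618c1 : ClassX2 (⟨1, 0, 1, (-21), 34⟩ : WeierstrassCurve ℚ) 3 :=
  ⟨by decide, not_irreducible_618c1, split_618c1.hasMultiplicativeReductionAtPrime⟩


/-! ## §3 The displays -/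

/-- **X2c INSTANCE — Mazur's main conjecture at `(618c1, 3)` by ROUTE P at a split prime** (row B11, sub-cell
`X2.CellCSplitNotGV`, `λ_an = 4`): door `B11SplitRouteP.mazurMC_of_cellC_of_split_of_routeP` (Kato–Wuthrich divisibility +
Greenberg's parity Prop. 3.10 + Stein–Wuthrich Thm. 6.1 with THE split §4.2 height); `CellC W 3` holds in the kernel
given the rank (`classX2_618c1`), `split_618c1` is the sign. CONDITIONAL only on the readings `hr`, `hμ0`, `hlam4`,
`hk` (`k = 2`), `hv` (`v = 2`), `hvt : ord_3 #tors = 1`, `hvc : ord_3 ∏c_v = 1` (the inequality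
`2 + 2·1 < 2 + 2 + 1` is then arithmetic). [cite: GreenbergLNM1716, Prop. 3.10 and §5 p. 183]
[cite: Wuthrich2014, Thm. 16 (p. 397)] [cite: SteinWuthrich2013, Thm. 6.1 (p. 20), §4.2, §4.4 (p. 18)] -/
theorem mazurMC_618c1_at_three_routeP
    (hWu : thm16_charIdeal_dvd_multiplicative_of_reducible)
    (hJs : thm61_splitMultiplicative) (hJn : thm61_nonsplitMultiplicative)
    (h310 : prop310_selmerCorank_mod_two_eq_lambdaInvariant)
    (hGZK : rank_eq_analyticRank_of_analyticRank_le_one)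
    (W : WeierstrassCurve ℚ) [W.IsElliptic] [W.IsGloballyMinimal] (hW : W = ⟨1, 0, 1, (-21), 34⟩)
    (hr : W.analyticRank = 1) (hμ0 : AnalyticMuLE W 3 0) (hlam4 : AnalyticLambdaEq W 3 4)
    (hk : ∀ Dq : TateParameterData W 3, (2 : ℤ) ≤ (LInvariant Dq).valuation)
    (hv : ∀ (Dq : TateParameterData W 3) (Dh : PAdicHeightData W 3), IsSplitMultCanonical Dh Dq →
      padicRegulator Dh ≠ 0 → (2 : ℤ) ≤ (padicRegulator Dh).valuation)
    (hvt : padicValNat 3 W.torsionOrder = 1) (hvc : padicValNat 3 W.tamagawaProduct = 1) :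
    MazurMainConjectureAt W 3 := by
  subst hW
  refine B11SplitRouteP.mazurMC_of_cellC_of_split_of_routeP _ 3 hWu hJs hJn h310 hGZK ⟨hr, classX2_618c1⟩
    split_618c1 hμ0 hlam4 hk hv ?_
  rw [hvt, hvc]; norm_num

/-- **X2c INSTANCE — Mazur's main conjecture at `(618c1, 3)` by the L3 CERTIFICATE** (second road; door
`B11L3.cellC_mazurMainConjectureAt_of_split_of_thm16_of_l3Certificate`: the certificate EQUALITY forces the Kato–Wuthrich
cofactor to be a unit of Λ — Stein–Wuthrich §11 remark). CONDITIONAL only on `hr` and `hcert` (`ord_{T=0} L = 2` — its `≥` half is theory, its content `[T²]L ≠ 0` is engine C v5's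
`v_3(b₂) = 1` conclusive read — and the valuation identity, two engines). No `(μ, λ)`, no parity, no inequality, no `hsha`.
[cite: SteinWuthrich2013, Thm. 6.1 (p. 20), §4.2 and §11 remark (p. 29)] [cite: Wuthrich2014, Thm. 16 (p. 397)] -/
theorem mazurMC_618c1_at_three_l3
    (hWu : thm16_charIdeal_dvd_multiplicative_of_reducible) (hJs : thm61_splitMultiplicative)
    (hGZK : rank_eq_analyticRank_of_analyticRank_le_one)
    (W : WeierstrassCurve ℚ) [W.IsElliptic] [W.IsGloballyMinimal] (hW : W = ⟨1, 0, 1, (-21), 34⟩)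
    (hr : W.analyticRank = 1)
    (hcert : ∀ {N : ℕ} [NeZero N] (f : CuspForm (Gamma0 N) 2), IsNewformOf W f →
      ∀ (ϖ : ℚ), (ϖ : ℝ) * W.realPeriodRat = plusPeriod f →
      ∀ (L : PowerSeries ℚ_[3]), IsSplitMultPAdicLFunctionOf f 3 L →
      ∀ (Dq : TateParameterData W 3) (Dh : PAdicHeightData W 3), IsSplitMultCanonical Dh Dq →
        L.order = ((2 : ℕ) : ℕ∞) ∧
        (((ϖ : ℚ) : ℚ_[3]) * PowerSeries.coeff 2 L *
            (padicLog 3 (cyclotomicGenerator 3) ^ 2 * (W.torsionOrder : ℚ_[3]) ^ 2)).valuation =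
          (LInvariant Dq * (W.tamagawaProduct : ℚ_[3]) * padicRegulator Dh).valuation) :
    MazurMainConjectureAt W 3 := by
  subst hW
  exact B11L3.cellC_mazurMainConjectureAt_of_split_of_thm16_of_l3Certificate _ 3 hWu hJs hGZK ⟨hr, classX2_618c1⟩
    split_618c1 hcert

/-- **X2c INSTANCE — `BSD(618c1, 3)` from the SAME L3 certificate** (k5-p3's door
`B11L3.bsdp_of_cellC_of_split_of_thm16_of_l3Certificate`: Kato–Wuthrich + Stein–Wuthrich + the certificate ⟹
`Ш[3^∞] = 0`; with `hsha : 3 ∤ #Ш_an`, Miller's `BSD(E,3)`). [cite: Wuthrich2014, Thm. 16 (p. 397)]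
[cite: SteinWuthrich2013, Thm. 6.1 (p. 20) and §4.2] [cite: Miller2011LMS, Def. 1.1 and Prop. 7.6] -/
theorem bsdp_618c1_at_three_l3
    (hWu : thm16_charIdeal_dvd_multiplicative_of_reducible) (hJs : thm61_splitMultiplicative)
    (hGZ : GrossZagier1986_thm_I_7_3) (hGZK : rank_eq_analyticRank_of_analyticRank_le_one)
    (hpar : nonempty_modularParametrizationData)
    (W : WeierstrassCurve ℚ) [W.IsElliptic] [W.IsGloballyMinimal] (hW : W = ⟨1, 0, 1, (-21), 34⟩)
    (hr : W.analyticRank = 1)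
    (hcert : ∀ {N : ℕ} [NeZero N] (f : CuspForm (Gamma0 N) 2), IsNewformOf W f →
      ∀ (ϖ : ℚ), (ϖ : ℝ) * W.realPeriodRat = plusPeriod f →
      ∀ (L : PowerSeries ℚ_[3]), IsSplitMultPAdicLFunctionOf f 3 L →
      ∀ (Dq : TateParameterData W 3) (Dh : PAdicHeightData W 3), IsSplitMultCanonical Dh Dq →
        L.order = ((2 : ℕ) : ℕ∞) ∧
        (((ϖ : ℚ) : ℚ_[3]) * PowerSeries.coeff 2 L *
            (padicLog 3 (cyclotomicGenerator 3) ^ 2 * (W.torsionOrder : ℚ_[3]) ^ 2)).valuation =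
          (LInvariant Dq * (W.tamagawaProduct : ℚ_[3]) * padicRegulator Dh).valuation)
    (hsha : ∀ s : ℚ, shaAn W = (s : ℂ) → padicValRat 3 s = 0) :
    BSDp W 3 := by
  subst hW
  exact B11L3.bsdp_of_cellC_of_split_of_thm16_of_l3Certificate _ 3 hWu hJs hGZ hGZK hpar ⟨hr, classX2_618c1⟩
    split_618c1 hcert hsha

/-- **The pair on the route's cell predicate, both conclusions**: `CellC 618c1 3 →` Mazur's main conjecture at the pair
`∧ BSD(618c1, 3)`, modulo the published facts and ONE L3 certificate (+ `hsha`) — crux 4's `X2.TargetC` shape with the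
main-conjecture rider. [cite: SteinWuthrich2013, Thm. 6.1 (p. 20) and §11 remark (p. 29)] [cite: Wuthrich2014, Thm. 16 (p. 397)] -/
theorem targetC_618c1_at_three_l3
    (hWu : thm16_charIdeal_dvd_multiplicative_of_reducible) (hJs : thm61_splitMultiplicative)
    (hGZ : GrossZagier1986_thm_I_7_3) (hGZK : rank_eq_analyticRank_of_analyticRank_le_one)
    (hpar : nonempty_modularParametrizationData)
    (W : WeierstrassCurve ℚ) [W.IsElliptic] [W.IsGloballyMinimal] (hW : W = ⟨1, 0, 1, (-21), 34⟩)
    (hcert : ∀ {N : ℕ} [NeZero N] (f : CuspForm (Gamma0 N) 2), IsNewformOf W f →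
      ∀ (ϖ : ℚ), (ϖ : ℝ) * W.realPeriodRat = plusPeriod f →
      ∀ (L : PowerSeries ℚ_[3]), IsSplitMultPAdicLFunctionOf f 3 L →
      ∀ (Dq : TateParameterData W 3) (Dh : PAdicHeightData W 3), IsSplitMultCanonical Dh Dq →
        L.order = ((2 : ℕ) : ℕ∞) ∧
        (((ϖ : ℚ) : ℚ_[3]) * PowerSeries.coeff 2 L *
            (padicLog 3 (cyclotomicGenerator 3) ^ 2 * (W.torsionOrder : ℚ_[3]) ^ 2)).valuation =
          (LInvariant Dq * (W.tamagawaProduct : ℚ_[3]) * padicRegulator Dh).valuation)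
    (hsha : ∀ s : ℚ, shaAn W = (s : ℂ) → padicValRat 3 s = 0) :
    CellC W 3 → MazurMainConjectureAt W 3 ∧ BSDp W 3 :=
  fun hc ↦ ⟨mazurMC_618c1_at_three_l3 hWu hJs hGZK W hW hc.1 hcert,
    bsdp_618c1_at_three_l3 hWu hJs hGZ hGZK hpar W hW hc.1 hcert hsha⟩

end Summit.BirchSwinnertonDyer.BirchSwinnertonDyer.Theorems.B11SplitRouteP618c1

end
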